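import Mathlib
import Literature.Analysis.FluidPDE.VectorCalculus
import Literature.Analysis.FluidPDE.AxisymmetricEuler
import Literature.Analysis.FluidPDE.SwirlTransportProofs
import Literature.Analysis.FluidPDE.LandauSolutions
import Literature.Analysis.FluidPDE.SverakLandauClassification
import Summits.NavierStokesRegularity.NavierStokesRegularity.Theorems.ThreadingFluxAzimuthalCartanDefs
import Summits.NavierStokesRegularity.NavierStokesRegularity.Theorems.ThreadingFluxAzimuthalCartanLandauBaseTools
import Summits.NavierStokesRegularity.NavierStokesRegularity.Theorems.ThreadingFluxAzimuthalCartanLieTilt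
import Summits.NavierStokesRegularity.NavierStokesRegularity.Theorems.ThreadingFluxAzimuthalCartanVertexWitnessGradient
import Summits.NavierStokesRegularity.NavierStokesRegularity.Theorems.ThreadingFluxAzimuthalCartanVertexWitnessMirrorTilt
import Literature.Analysis.FluidPDE.VorticityCalculus
import Literature.Analysis.FluidPDE.BiotSavartNewtonKernel
import Literature.Analysis.FluidPDE.BiotSavartCurlPair
import Summits.NavierStokesRegularity.NavierStokesRegularity.Theorems.TypeIQuarterGateScarEnvelopeTypeIForcedTsaiStokesletSelfAdvection
import Summits.NavierStokesRegularity.NavierStokesRegularity.Theorems.ThreadingFluxHorizonTowerProfileCurlT1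
import HarnessLib

/-!
# Crux `PoloidalLiouville` (stmt-NavierStokesRegularity-1222, W1), crux idea «azimuthal-cartan-test» (ns-idea-15 g10, V26),
# V♯ `LandauVertexFlexibility`: the explicit witness is NOT «tilt + J₃-equivariant» (assembly) — and V♯ modulo ONE identity

V♯ (sketch `Cruxes/PoloidalLiouville/AzimuthalCartanSketch.lean` v1.3b l.330; Defs twin `ThreadingFluxAzimuthalCartanDefs`):
`∃ δv δp, analytic on landauTorus ∧ LinearisedSteadyNSOn landauTorus landau2 δv δp ∧ IsUnthreadedOn landauTorus 0 δv ∧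
¬ ∃ Ω, IsEquivariantOn landauTorus 0 J3 (δv − tilt landau2 0 Ω)`.  For the explicit mode-2 witness `δv = ∇θ + g·id`
(`θ = (x₀² − x₁²)(10r − 8x₂)/((r − x₂)²(2r − x₂))`, `g = 6θ/(2r − x₂)²`; crux note `AzimuthalCartanVertexWitness.md`) this file proves the
LAST clause BY NAME:

★ `not_isEquivariantOn_witness_sub_tilt` — if `δv − tilt landau2 0 Ω` were `J₃`-equivariant on the torus, `LieTilt.lieJ3_of_sub_tilt_equivariant`
(tilts of the axisymmetric `C²` base are mode 1; the witness is differentiable on the torus, `differentiableAt_witness`) would give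
`Dδv(x)(J₃x) − J₃δv(x) = −tilt landau2 0 (J₃Ω) x` on the torus; its `e₁`-component at the mirror points `q_{±1} = (±3, 0, 4)` reads
`∓36 = −Ω₁/3` (`lie_witness_apply_one`: the witness side is ODD under `x₀ ↦ −x₀`; `tilt_landau2_J3_apply_one`: the tilt side is EVEN) — ⊥.

The other three clauses are restated here BY NAME on `landauTorus` (`analyticOnNhd_witness_landauTorus`, `analyticOnNhd_witnessPressure_landauTorus`,
`isUnthreadedOn_witness_landauTorus`; same arguments as the δ-unfolded versions of `…VertexWitness.lean`, p709113), and the file ends with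
★★ `landauVertexFlexibility_of_linearisedSteadyNSOn : LinearisedSteadyNSOn landauTorus landau2 δv δp → LandauVertexFlexibility` — V♯ REDUCED TO
ONE EXPLICIT IDENTITY for the explicit pair (second derivatives of `θ`; 60-digit finite-difference residual ≤ 1.3e-15 recorded in the crux note;
NOT proved here), so V♯ itself is NOT closed here.  `PoloidalLiouville` (1222), W1 and
NS regularity stay OPEN / NOT proved.  `--supports stmt-NavierStokesRegularity-1222 --as helper`; 0 kit.  [folklore]
-/

-- the summit and its single problem share the name (D-0017 nested layout)
set_option linter.dupNamespace false

noncomputable section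

open Set Function Metric
open scoped RealInnerProductSpace
open Literature.Analysis.FluidPDE

namespace Summit.NavierStokesRegularity.NavierStokesRegularity.Theorems.PoloidalLiouville.AzimuthalCartan

open Summit.NavierStokesRegularity.NavierStokesRegularity.Theorems
open Summit.NavierStokesRegularity.NavierStokesRegularity.Theorems.PoloidalLiouville.CentreJet (E3)
open Summit.NavierStokesRegularity.NavierStokesRegularity.Theorems.LandauTail
open Summit.NavierStokesRegularity.NavierStokesRegularity.Cruxes.ScarEnvelopeTypeI.ForcedTsai
  (curl_gradient_eq_zero_of_contDiffAt curl_id_eq_zero)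
open Summit.NavierStokesRegularity.NavierStokesRegularity.Theorems.PoloidalLiouville.HorizonTower (inner_cross_self_right)

namespace VertexWitness

/-- ★ **V♯ `LandauVertexFlexibility`, last clause, for the explicit witness** (BY NAME over the Defs twin):
`¬ ∃ Ω, IsEquivariantOn landauTorus 0 J3 (δv − tilt landau2 0 Ω)` — the two mirror points force `−36 = −Ω₁/3 = 36`.
(The witness's `LinearisedSteadyNSOn` clause is NOT proved here; V♯, `PoloidalLiouville` and NS regularity stay OPEN.) [folklore] -/
theorem not_isEquivariantOn_witness_sub_tilt :
    ¬ ∃ Ω : E3, IsEquivariantOn landauTorus 0 J3 ((fun y : E3 =>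
      gradient (fun y : E3 => (y 0 ^ 2 - y 1 ^ 2) * (10 * ‖y‖ - 8 * y 2) / ((‖y‖ - y 2) ^ 2 * (2 * ‖y‖ - y 2))) y +
        (6 * ((y 0 ^ 2 - y 1 ^ 2) * (10 * ‖y‖ - 8 * y 2) / ((‖y‖ - y 2) ^ 2 * (2 * ‖y‖ - y 2))) / (2 * ‖y‖ - y 2) ^ 2) • y) -
      tilt landau2 0 Ω) := by
  set δv : E3 → E3 := fun y : E3 =>
      gradient (fun y : E3 => (y 0 ^ 2 - y 1 ^ 2) * (10 * ‖y‖ - 8 * y 2) / ((‖y‖ - y 2) ^ 2 * (2 * ‖y‖ - y 2))) y +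
        (6 * ((y 0 ^ 2 - y 1 ^ 2) * (10 * ‖y‖ - 8 * y 2) / ((‖y‖ - y 2) ^ 2 * (2 * ‖y‖ - y 2))) / (2 * ‖y‖ - y 2) ^ 2) • y
    with hδv
  rintro ⟨Ω, heq⟩
  have hV : IsAxisymmetric landau2 := by
    have h := isAxisymmetric_landauSolution (ν := 1) (A := (2 : ℝ))
    rwa [landauSolution_one] at h
  have hW : ∀ x ∈ landauTorus, DifferentiableAt ℝ δv x := fun x hx =>
    differentiableAt_witness (norm_ne_apply_two_of_mem_landauTorus hx)
  have h2 : ∀ x ∈ landauTorus, ContDiffAt ℝ 2 landau2 x := fun x hx =>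
    contDiffAt_landauAxisField LandauBase.norm_e2 LandauBase.one_lt_abs_two (LandauBase.ne_zero_of_mem_torus hx)
  have key : ∀ s : ℝ, s = 1 ∨ s = -1 → -36 * s = -(Ω 1 / 3) := by
    intro s hs
    have h := LieTilt.lieJ3_of_sub_tilt_equivariant hV hW h2 heq (q_mem_landauTorus hs)
    have A := congrArg (fun v : E3 => v 1) h
    simp only [PiLp.sub_apply, PiLp.neg_apply] at A
    have e1 : (fderiv ℝ δv (EuclideanSpace.single 0 (3 * s) + EuclideanSpace.single 2 4 : E3)
        (J3 (EuclideanSpace.single 0 (3 * s) + EuclideanSpace.single 2 4 : E3))) 1 -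
        (J3 (δv (EuclideanSpace.single 0 (3 * s) + EuclideanSpace.single 2 4 : E3))) 1 = -36 * s :=
      lie_witness_apply_one hs
    have e2 := tilt_landau2_J3_apply_one hs Ω
    linarith
  have k1 := key 1 (Or.inl rfl)
  have k2 := key (-1) (Or.inr rfl)
  linarith

/-! ### The other clauses BY NAME and V♯ modulo the linearised momentum identity -/

/-- **V♯ clause «analytic δv», BY NAME on `landauTorus`** (`θ`, `g` are `C^ω` off the ray; the gradient of a `C^ω` map is `C^ω`). [folklore] -/
theorem analyticOnNhd_witness_landauTorus :
    AnalyticOnNhd ℝ (fun y : E3 =>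
      gradient (fun y : E3 => (y 0 ^ 2 - y 1 ^ 2) * (10 * ‖y‖ - 8 * y 2) / ((‖y‖ - y 2) ^ 2 * (2 * ‖y‖ - y 2))) y +
        (6 * ((y 0 ^ 2 - y 1 ^ 2) * (10 * ‖y‖ - 8 * y 2) / ((‖y‖ - y 2) ^ 2 * (2 * ‖y‖ - y 2))) / (2 * ‖y‖ - y 2) ^ 2) • y)
      landauTorus := by
  intro x hxT
  have hx : ‖x‖ ≠ x 2 := norm_ne_apply_two_of_mem_landauTorus hxT
  have hle : x 2 ≤ ‖x‖ := (le_abs_self _).trans (by simpa using PiLp.norm_apply_le x 2)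
  have h0 : x ≠ 0 := fun h => hx (by rw [h]; simp)
  have h1 : ‖x‖ - x 2 ≠ 0 := sub_ne_zero.2 hx
  have h2 : 2 * ‖x‖ - x 2 ≠ 0 := by
    intro h
    have : ‖x‖ = 0 := by linarith [norm_nonneg x]
    rw [norm_eq_zero] at this
    exact hx (by rw [this]; simp)
  have hn : ContDiffAt ℝ (⊤ : WithTop ℕ∞) (fun y : E3 => ‖y‖) x := contDiffAt_norm ℝ h0
  have hc : ∀ i : Fin 3, ContDiffAt ℝ (⊤ : WithTop ℕ∞) (fun y : E3 => y i) x := fun i =>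
    (EuclideanSpace.proj i : E3 →L[ℝ] ℝ).contDiff.contDiffAt
  have hM0 : (‖x‖ - x 2) ^ 2 * (2 * ‖x‖ - x 2) ≠ 0 := mul_ne_zero (pow_ne_zero 2 h1) h2
  have hθ : ContDiffAt ℝ (⊤ : WithTop ℕ∞) (fun y : E3 => (y 0 ^ 2 - y 1 ^ 2) * (10 * ‖y‖ - 8 * y 2) /
      ((‖y‖ - y 2) ^ 2 * (2 * ‖y‖ - y 2))) x :=
    ((((hc 0).pow 2).sub ((hc 1).pow 2)).mul ((contDiffAt_const.mul hn).sub (contDiffAt_const.mul (hc 2)))).div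
      (((hn.sub (hc 2)).pow 2).mul ((contDiffAt_const.mul hn).sub (hc 2))) hM0
  have hg : ContDiffAt ℝ (⊤ : WithTop ℕ∞) (fun y : E3 => 6 * ((y 0 ^ 2 - y 1 ^ 2) * (10 * ‖y‖ - 8 * y 2) /
      ((‖y‖ - y 2) ^ 2 * (2 * ‖y‖ - y 2))) / (2 * ‖y‖ - y 2) ^ 2) x :=
    (contDiffAt_const.mul hθ).div (((contDiffAt_const.mul hn).sub (hc 2)).pow 2) (pow_ne_zero 2 h2)
  have hG : ContDiffAt ℝ (⊤ : WithTop ℕ∞) (gradient (fun y : E3 => (y 0 ^ 2 - y 1 ^ 2) * (10 * ‖y‖ - 8 * y 2) /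
      ((‖y‖ - y 2) ^ 2 * (2 * ‖y‖ - y 2)))) x := by
    have e : gradient (fun y : E3 => (y 0 ^ 2 - y 1 ^ 2) * (10 * ‖y‖ - 8 * y 2) / ((‖y‖ - y 2) ^ 2 * (2 * ‖y‖ - y 2))) =
        fun y => (InnerProductSpace.toDual ℝ E3).symm (fderiv ℝ (fun y : E3 => (y 0 ^ 2 - y 1 ^ 2) * (10 * ‖y‖ - 8 * y 2) /
          ((‖y‖ - y 2) ^ 2 * (2 * ‖y‖ - y 2))) y) := rfl
    rw [e]
    exact (InnerProductSpace.toDual ℝ E3).symm.toContinuousLinearEquiv.contDiff.contDiffAt.comp x (hθ.fderiv_right le_rfl)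
  exact hG.analyticAt.add (hg.analyticAt.smul analyticAt_id)

/-- **V♯ clause «analytic δp», BY NAME on `landauTorus`** (`δp = g − ⟨∇Φ, ∇θ⟩`, `Φ = log(3r²/(2r − x₂)²)`). [folklore] -/
theorem analyticOnNhd_witnessPressure_landauTorus :
    AnalyticOnNhd ℝ (fun y : E3 =>
      6 * ((y 0 ^ 2 - y 1 ^ 2) * (10 * ‖y‖ - 8 * y 2) / ((‖y‖ - y 2) ^ 2 * (2 * ‖y‖ - y 2))) / (2 * ‖y‖ - y 2) ^ 2 -
        inner ℝ (gradient (fun y : E3 => Real.log (3 * ‖y‖ ^ 2 / (2 * ‖y‖ - y 2) ^ 2)) y)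
          (gradient (fun y : E3 => (y 0 ^ 2 - y 1 ^ 2) * (10 * ‖y‖ - 8 * y 2) / ((‖y‖ - y 2) ^ 2 * (2 * ‖y‖ - y 2))) y))
      landauTorus := by
  intro x hxT
  have hx : ‖x‖ ≠ x 2 := norm_ne_apply_two_of_mem_landauTorus hxT
  have hle : x 2 ≤ ‖x‖ := (le_abs_self _).trans (by simpa using PiLp.norm_apply_le x 2)
  have h0 : x ≠ 0 := fun h => hx (by rw [h]; simp)
  have h1 : ‖x‖ - x 2 ≠ 0 := sub_ne_zero.2 hx
  have h2 : 2 * ‖x‖ - x 2 ≠ 0 := by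
    intro h
    have : ‖x‖ = 0 := by linarith [norm_nonneg x]
    rw [norm_eq_zero] at this
    exact hx (by rw [this]; simp)
  have hn : ContDiffAt ℝ (⊤ : WithTop ℕ∞) (fun y : E3 => ‖y‖) x := contDiffAt_norm ℝ h0
  have hc : ∀ i : Fin 3, ContDiffAt ℝ (⊤ : WithTop ℕ∞) (fun y : E3 => y i) x := fun i =>
    (EuclideanSpace.proj i : E3 →L[ℝ] ℝ).contDiff.contDiffAt
  have hM0 : (‖x‖ - x 2) ^ 2 * (2 * ‖x‖ - x 2) ≠ 0 := mul_ne_zero (pow_ne_zero 2 h1) h2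
  have hθ : ContDiffAt ℝ (⊤ : WithTop ℕ∞) (fun y : E3 => (y 0 ^ 2 - y 1 ^ 2) * (10 * ‖y‖ - 8 * y 2) /
      ((‖y‖ - y 2) ^ 2 * (2 * ‖y‖ - y 2))) x :=
    ((((hc 0).pow 2).sub ((hc 1).pow 2)).mul ((contDiffAt_const.mul hn).sub (contDiffAt_const.mul (hc 2)))).div
      (((hn.sub (hc 2)).pow 2).mul ((contDiffAt_const.mul hn).sub (hc 2))) hM0
  have hg : ContDiffAt ℝ (⊤ : WithTop ℕ∞) (fun y : E3 => 6 * ((y 0 ^ 2 - y 1 ^ 2) * (10 * ‖y‖ - 8 * y 2) /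
      ((‖y‖ - y 2) ^ 2 * (2 * ‖y‖ - y 2))) / (2 * ‖y‖ - y 2) ^ 2) x :=
    (contDiffAt_const.mul hθ).div (((contDiffAt_const.mul hn).sub (hc 2)).pow 2) (pow_ne_zero 2 h2)
  have hgrad : ∀ {φ : E3 → ℝ}, ContDiffAt ℝ (⊤ : WithTop ℕ∞) φ x → ContDiffAt ℝ (⊤ : WithTop ℕ∞) (gradient φ) x := by
    intro φ hφ
    have e : gradient φ = fun y => (InnerProductSpace.toDual ℝ E3).symm (fderiv ℝ φ y) := rfl
    rw [e]
    exact (InnerProductSpace.toDual ℝ E3).symm.toContinuousLinearEquiv.contDiff.contDiffAt.comp x (hφ.fderiv_right le_rfl)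
  have hΦ : ContDiffAt ℝ (⊤ : WithTop ℕ∞) (fun y : E3 => Real.log (3 * ‖y‖ ^ 2 / (2 * ‖y‖ - y 2) ^ 2)) x := by
    refine ((contDiffAt_const.mul (hn.pow 2)).div (((contDiffAt_const.mul hn).sub (hc 2)).pow 2) (pow_ne_zero 2 h2)).log ?_
    have hr : 0 < ‖x‖ := norm_pos_iff.2 h0
    have hD : 0 < (2 * ‖x‖ - x 2) ^ 2 := by positivity
    exact (div_pos (by positivity) hD).ne'
  exact (hg.sub ((hgrad hΦ).inner ℝ (hgrad hθ))).analyticAt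

/-- **V♯ clause «unthreaded about the vertex», BY NAME**: `IsUnthreadedOn landauTorus 0 δv` (`curl (∇θ + g·id) = ∇g × id ⊥ id`). [folklore] -/
theorem isUnthreadedOn_witness_landauTorus :
    IsUnthreadedOn landauTorus 0 (fun y : E3 =>
      gradient (fun y : E3 => (y 0 ^ 2 - y 1 ^ 2) * (10 * ‖y‖ - 8 * y 2) / ((‖y‖ - y 2) ^ 2 * (2 * ‖y‖ - y 2))) y +
        (6 * ((y 0 ^ 2 - y 1 ^ 2) * (10 * ‖y‖ - 8 * y 2) / ((‖y‖ - y 2) ^ 2 * (2 * ‖y‖ - y 2))) / (2 * ‖y‖ - y 2) ^ 2) • y) := by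
  intro x hxT
  have hx : ‖x‖ ≠ x 2 := norm_ne_apply_two_of_mem_landauTorus hxT
  have hle : x 2 ≤ ‖x‖ := (le_abs_self _).trans (by simpa using PiLp.norm_apply_le x 2)
  have h0 : x ≠ 0 := fun h => hx (by rw [h]; simp)
  have h1 : ‖x‖ - x 2 ≠ 0 := sub_ne_zero.2 hx
  have h2 : 2 * ‖x‖ - x 2 ≠ 0 := by
    intro h
    have : ‖x‖ = 0 := by linarith [norm_nonneg x]
    rw [norm_eq_zero] at this
    exact hx (by rw [this]; simp)
  have hn : ContDiffAt ℝ 2 (fun y : E3 => ‖y‖) x := contDiffAt_norm ℝ h0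
  have hc : ∀ i : Fin 3, ContDiffAt ℝ 2 (fun y : E3 => y i) x := fun i =>
    (EuclideanSpace.proj i : E3 →L[ℝ] ℝ).contDiff.contDiffAt
  have hM0 : (‖x‖ - x 2) ^ 2 * (2 * ‖x‖ - x 2) ≠ 0 := mul_ne_zero (pow_ne_zero 2 h1) h2
  have hθ : ContDiffAt ℝ 2 (fun y : E3 => (y 0 ^ 2 - y 1 ^ 2) * (10 * ‖y‖ - 8 * y 2) /
      ((‖y‖ - y 2) ^ 2 * (2 * ‖y‖ - y 2))) x :=
    ((((hc 0).pow 2).sub ((hc 1).pow 2)).mul ((contDiffAt_const.mul hn).sub (contDiffAt_const.mul (hc 2)))).div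
      (((hn.sub (hc 2)).pow 2).mul ((contDiffAt_const.mul hn).sub (hc 2))) hM0
  have hg : DifferentiableAt ℝ (fun y : E3 => 6 * ((y 0 ^ 2 - y 1 ^ 2) * (10 * ‖y‖ - 8 * y 2) /
      ((‖y‖ - y 2) ^ 2 * (2 * ‖y‖ - y 2))) / (2 * ‖y‖ - y 2) ^ 2) x :=
    ((contDiffAt_const.mul hθ).div (((contDiffAt_const.mul hn).sub (hc 2)).pow 2) (pow_ne_zero 2 h2)).differentiableAt
      two_ne_zero
  -- `curl (∇θ + g·id)(x) = ∇g(x) × x`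
  obtain ⟨hdg, hcurl⟩ := curl_gradient_eq_zero_of_contDiffAt hθ
  have hid : DifferentiableAt ℝ (fun y : E3 => y) x := differentiableAt_id
  have hsm : DifferentiableAt ℝ (fun y : E3 => (6 * ((y 0 ^ 2 - y 1 ^ 2) * (10 * ‖y‖ - 8 * y 2) /
      ((‖y‖ - y 2) ^ 2 * (2 * ‖y‖ - y 2))) / (2 * ‖y‖ - y 2) ^ 2) • y) x := hg.smul hid
  rw [sub_zero, curl_add hdg hsm, hcurl, zero_add, curl_smul hg hid, curl_id_eq_zero, smul_zero, zero_add,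
    fderiv_eq_innerSL_gradient, curlCLM_smulRight_innerSL]
  exact inner_cross_self_right _ _

/-- ★★ **V♯ `LandauVertexFlexibility` REDUCED TO ONE EXPLICIT IDENTITY**: if the explicit witness pair `(δv, δp)` satisfies the linearised
steady Navier–Stokes system at Landau's flow on the torus (`LinearisedSteadyNSOn landauTorus landau2 δv δp` — checked numerically to 60
digits in the crux note, NOT proved here), then V♯ holds (the other four conjuncts are this file's by-name clauses).  V♯ itself,
`PoloidalLiouville` (1222), W1 and NS regularity stay OPEN / NOT proved. [folklore] -/
theorem landauVertexFlexibility_of_linearisedSteadyNSOn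
    (h : LinearisedSteadyNSOn landauTorus landau2
      (fun y : E3 =>
        gradient (fun y : E3 => (y 0 ^ 2 - y 1 ^ 2) * (10 * ‖y‖ - 8 * y 2) / ((‖y‖ - y 2) ^ 2 * (2 * ‖y‖ - y 2))) y +
          (6 * ((y 0 ^ 2 - y 1 ^ 2) * (10 * ‖y‖ - 8 * y 2) / ((‖y‖ - y 2) ^ 2 * (2 * ‖y‖ - y 2))) / (2 * ‖y‖ - y 2) ^ 2) • y)
      (fun y : E3 =>
        6 * ((y 0 ^ 2 - y 1 ^ 2) * (10 * ‖y‖ - 8 * y 2) / ((‖y‖ - y 2) ^ 2 * (2 * ‖y‖ - y 2))) / (2 * ‖y‖ - y 2) ^ 2 -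
          inner ℝ (gradient (fun y : E3 => Real.log (3 * ‖y‖ ^ 2 / (2 * ‖y‖ - y 2) ^ 2)) y)
            (gradient (fun y : E3 => (y 0 ^ 2 - y 1 ^ 2) * (10 * ‖y‖ - 8 * y 2) / ((‖y‖ - y 2) ^ 2 * (2 * ‖y‖ - y 2))) y))) :
    LandauVertexFlexibility :=
  ⟨_, _, analyticOnNhd_witness_landauTorus, analyticOnNhd_witnessPressure_landauTorus, h, isUnthreadedOn_witness_landauTorus,
    not_isEquivariantOn_witness_sub_tilt⟩

end VertexWitness

end Summit.NavierStokesRegularity.NavierStokesRegularity.Theorems.PoloidalLiouville.AzimuthalCartan
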